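import Mathlib
import Summits.ValiantsHypothesis.ValiantsHypothesis.Theses.ValuativeGCT

/-!
# Four-row slice bound, part 1: counting and bookkeeping lemmas

Helper lemmas for the det-side stub `stub_fourRowSliceBound` of line `four-row-count` for crux
`ValuativeGCT.ValuativeFlip` (stmt-ValiantsHypothesis-12624), the four-row analogue of the
landed B1 `stub_sliceBound` (`Theorems/ValuativeGCTValuativeFlipSliceBound.lean`):

* `fr_finrank_homogeneousSubmodule_sum_le` — the SHARP monomial count: degree-`D` forms in the
  variables `Unit ⊕ τ` span a space of dimension at most `(D+1)^(#τ)` (a degree-`D` monomial is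
  determined by its exponents on `τ`; the crude count of B1 has exponent `#τ + 1`);
* `fr_eval_congr_supported` — a polynomial supported on a set of variables `s` has the same
  value at two points that agree on `s`;
* `fr_diag_mul_diag_inv`, `fr_diag_conj_apply` — conjugation by the one-parameter torus
  `diag(1, r, r², …)`, used to normalise the subdiagonal of the companion slot;
* `fr_card_keptOther_le` — among the row slots `j : MatIdx N` with `N² ≤ idx(j) + 4` (the last
  four slots in the lexicographic enumeration `matIdxEquiv`) at most two differ from the two
  distinguished slots of index `N² - 1` and `N² - 2`.

Everything is elementary; no named facts are used.
-/

-- `Summit.ValiantsHypothesis.ValiantsHypothesis.…` is the tree's mandated single-conjunct layout (Sub = Summit).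
set_option linter.dupNamespace false

namespace Summit.ValiantsHypothesis.ValiantsHypothesis.Theorems.ValuativeFlip

open MvPolynomial
open scoped BigOperators Matrix
open Literature.NumberTheory.DiophantineGeometry

noncomputable section

/-- **Sharp monomial count.** Degree-`D` forms in the variables `Unit ⊕ τ` (`τ` finite) span a
space of dimension at most `(D+1)^(#τ)`: such a form is a combination of the monomials `X^d`
with `|d| = D`, and `d` is determined by its restriction to `τ` (each exponent `≤ D`), the
exponent at the extra variable being `D - ∑_{i ∈ τ} d_i`. [folklore] -/
theorem fr_finrank_homogeneousSubmodule_sum_le (τ : Type*) [Fintype τ] [DecidableEq τ] (D : ℕ) :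
    Module.finrank ℂ ↥(MvPolynomial.homogeneousSubmodule (Unit ⊕ τ) ℂ D) ≤ (D + 1) ^ Fintype.card τ := by
  classical
  let e : (τ → Fin (D + 1)) → ((Unit ⊕ τ) →₀ ℕ) := fun g =>
    Finsupp.equivFunOnFinite.symm (Sum.elim (fun _ => D - ∑ i, (g i : ℕ)) fun i => (g i : ℕ))
  let b : (τ → Fin (D + 1)) → MvPolynomial (Unit ⊕ τ) ℂ := fun g => monomial (e g) 1
  have hle : homogeneousSubmodule (Unit ⊕ τ) ℂ D ≤ Submodule.span ℂ (Set.range b) := by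
    intro φ hφ
    rw [mem_homogeneousSubmodule] at hφ
    rw [φ.as_sum]
    refine Submodule.sum_mem _ fun d hd => ?_
    have hdeg : d.degree = D := by
      by_contra h
      exact (mem_support_iff.mp hd) (hφ.coeff_eq_zero h)
    have hs : d.degree = ∑ x, d x := by
      unfold Finsupp.degree
      exact Finset.sum_subset (Finset.subset_univ _) (fun x _ hx => Finsupp.notMem_support_iff.mp hx)
    have hsum : d (Sum.inl ()) + ∑ i, d (Sum.inr i) = D := by
      rw [← hdeg, hs, Fintype.sum_sum_type]
      simp only [Finset.univ_unique, Finset.sum_singleton, PUnit.default_eq_unit]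
    have hdi : ∀ i, d (Sum.inr i) < D + 1 := fun i =>
      Nat.lt_succ_of_le (hdeg ▸ Finsupp.le_degree (Sum.inr i) d)
    have hed : e (fun i => ⟨d (Sum.inr i), hdi i⟩) = d := by
      ext x
      rcases x with ⟨⟨⟩⟩ | i
      · simp only [e, Finsupp.coe_equivFunOnFinite_symm, Sum.elim_inl]
        show D - ∑ i, d (Sum.inr i) = d (Sum.inl ())
        omega
      · simp [e]
    have : monomial d (coeff d φ) = coeff d φ • b (fun i => ⟨d (Sum.inr i), hdi i⟩) := by
      rw [smul_monomial, smul_eq_mul, mul_one, hed]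
    rw [this]
    exact Submodule.smul_mem _ _ (Submodule.subset_span (Set.mem_range_self _))
  haveI : Module.Finite ℂ (Submodule.span ℂ (Set.range b)) :=
    Module.Finite.iff_fg.mpr (Submodule.fg_span (Set.finite_range b))
  calc Module.finrank ℂ ↥(homogeneousSubmodule (Unit ⊕ τ) ℂ D)
      ≤ Module.finrank ℂ (Submodule.span ℂ (Set.range b)) := Submodule.finrank_mono hle
    _ ≤ Fintype.card (τ → Fin (D + 1)) := finrank_range_le_card b
    _ = (D + 1) ^ Fintype.card τ := by rw [Fintype.card_fun, Fintype.card_fin]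

/-- A polynomial supported on the variables `s` takes equal values at two points agreeing on `s`.
[folklore] -/
theorem fr_eval_congr_supported {σ : Type*} {s : Set σ} {G : MvPolynomial σ ℂ}
    (hG : G ∈ supported ℂ s) {x y : σ → ℂ} (h : ∀ p ∈ s, x p = y p) : eval x G = eval y G :=
  eval₂Hom_congr' rfl (fun i hi _ => h i (mem_supported.mp hG hi)) rfl

/-- The torus element `diag(1, r, …, r^(N-1))` times `diag(1, r⁻¹, …, r^-(N-1))` is `1` (`r ≠ 0`).
[folklore] -/
theorem fr_diag_mul_diag_inv (N : ℕ) (r : ℂ) (hr : r ≠ 0) :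
    Matrix.diagonal (fun k : Fin N => r ^ (k : ℕ)) *
      Matrix.diagonal (fun k : Fin N => r⁻¹ ^ (k : ℕ)) = 1 := by
  rw [Matrix.diagonal_mul_diagonal, ← Matrix.diagonal_one]
  congr 1
  funext k
  rw [← mul_pow, mul_inv_cancel₀ hr, one_pow]

/-- Entries of a matrix conjugated by the torus element `diag(1, r, …, r^(N-1))`:
`(D M D⁻¹) c d = r^c · M c d · r^-d`. [folklore] -/
theorem fr_diag_conj_apply (N : ℕ) (r : ℂ) (M : Matrix (Fin N) (Fin N) ℂ) (c d : Fin N) :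
    (Matrix.diagonal (fun k : Fin N => r ^ (k : ℕ)) * M *
      Matrix.diagonal (fun k : Fin N => r⁻¹ ^ (k : ℕ))) c d = r ^ (c : ℕ) * M c d * r⁻¹ ^ (d : ℕ) := by
  rw [Matrix.mul_diagonal, Matrix.diagonal_mul]

/-- On the subdiagonal the conjugation by `diag(1, r, …)` multiplies by `r`:
`r^(d+1) · u · r^-d = r · u`  (`r ≠ 0`). [folklore] -/
theorem fr_pow_succ_mul_inv_pow (r u : ℂ) (hr : r ≠ 0) (d : ℕ) :
    r ^ (d + 1) * u * r⁻¹ ^ d = r * u := by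
  rw [pow_succ, inv_pow, mul_assoc, mul_assoc, mul_comm u, ← mul_assoc, ← mul_assoc,
    mul_assoc (r ^ d), mul_comm r, ← mul_assoc, mul_inv_cancel₀ (pow_ne_zero d hr), one_mul]

/-- The determinant of the torus element `diag(1, r, …, r^(N-1))` is nonzero for `r ≠ 0`.
[folklore] -/
theorem fr_det_diag_ne_zero (N : ℕ) (r : ℂ) (hr : r ≠ 0) :
    (Matrix.diagonal (fun k : Fin N => r ^ (k : ℕ))).det ≠ 0 := by
  rw [Matrix.det_diagonal]
  exact Finset.prod_ne_zero_iff.mpr fun k _ => pow_ne_zero _ hr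

/-- The lexicographic index of the matrix position `(a, b)` is `b + N·a`. [folklore] -/
theorem fr_idx_toLex (N : ℕ) (a b : Fin N) :
    (((matIdxEquiv N).symm (toLex (a, b)) : Fin (N * N)) : ℕ) = b + N * a := by
  simp [matIdxEquiv]

/-- The lexicographic index `j ↦ idx(j)` is injective. [folklore] -/
theorem fr_idx_injective (N : ℕ) :
    Function.Injective fun j : MatIdx N => (((matIdxEquiv N).symm j : Fin (N * N)) : ℕ) :=
  fun _ _ h => (matIdxEquiv N).symm.injective (Fin.ext h)

/-- **At most two further kept slots.** Among the row slots `j` with `N·N ≤ idx(j) + 4` (the last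
four in the lexicographic enumeration), those with `idx(j) + 1 ≠ N·N` and `idx(j) + 2 ≠ N·N`
number at most two (their indices are `N·N - 4` and `N·N - 3`). [folklore] -/
theorem fr_card_keptOther_le (N : ℕ) [DecidablePred fun j : MatIdx N =>
      N * N ≤ (((matIdxEquiv N).symm j : Fin (N * N)) : ℕ) + 4 ∧
        ¬((((matIdxEquiv N).symm j : Fin (N * N)) : ℕ) + 1 = N * N ∨
          (((matIdxEquiv N).symm j : Fin (N * N)) : ℕ) + 2 = N * N)] :
    Fintype.card {j : MatIdx N // N * N ≤ (((matIdxEquiv N).symm j : Fin (N * N)) : ℕ) + 4 ∧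
        ¬((((matIdxEquiv N).symm j : Fin (N * N)) : ℕ) + 1 = N * N ∨
          (((matIdxEquiv N).symm j : Fin (N * N)) : ℕ) + 2 = N * N)} ≤ 2 := by
  let f : {j : MatIdx N // N * N ≤ (((matIdxEquiv N).symm j : Fin (N * N)) : ℕ) + 4 ∧
        ¬((((matIdxEquiv N).symm j : Fin (N * N)) : ℕ) + 1 = N * N ∨
          (((matIdxEquiv N).symm j : Fin (N * N)) : ℕ) + 2 = N * N)} → Fin 2 :=
    fun j => if (((matIdxEquiv N).symm j.1 : Fin (N * N)) : ℕ) + 4 = N * N then 0 else 1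
  have hf : Function.Injective f := by
    rintro ⟨j, hj, hj'⟩ ⟨j', hk, hk'⟩ h
    have hlt : (((matIdxEquiv N).symm j : Fin (N * N)) : ℕ) < N * N := Fin.is_lt _
    have hlt' : (((matIdxEquiv N).symm j' : Fin (N * N)) : ℕ) < N * N := Fin.is_lt _
    have heq : (((matIdxEquiv N).symm j : Fin (N * N)) : ℕ) =
        (((matIdxEquiv N).symm j' : Fin (N * N)) : ℕ) := by
      simp only [f] at h
      split_ifs at h with h1 h2 h2
      · omega
      · exact absurd h (by decide)
      · exact absurd h (by decide)
      · omega
    exact Subtype.ext (fr_idx_injective N heq)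
  simpa using Fintype.card_le_of_injective f hf

end

end Summit.ValiantsHypothesis.ValiantsHypothesis.Theorems.ValuativeFlip
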